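/-
Copyright (c) 2026 the pub-hodgecm-mathlib formalisation cell (harness21).  Prover seat hodgecm-mathlib-K2E4-p09 (g3),
Track B «K2-LIT» ∕ h413 (`stmt-HodgeConjecture-24833`), line `K2_E3_EllipticInputs`, unit U12 §L, kernel road «RICHARDSON» for (L-B_GL)
(`sig_K2E3GLnNilpotentFourierRegularGeThree`, all `N`), deal (D57) (a)+(b) «SUBSPACE FOURIER ∕ ANNIHILATOR», GENERIC FORM: `∫_W 𝓕f = c · ∫_{W^⊥} f`.  2026-09-04.
-/
import Summits.HodgeConjecture.HodgeConjecture.Theorems.K2E3GLnNilBlockSubspaceFourier   -- ★ p857253 (K2E3-p11 g4) block form + `exists_forall_add_eq_of_entries_mem`, `integral_piFourierSB_eq_const_mul_apply_zero`; ★ K1 p857137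
import Mathlib.LinearAlgebra.Dual.Lemmas
import Mathlib.LinearAlgebra.Basis.VectorSpace
import Mathlib.LinearAlgebra.FiniteDimensional.Lemmas
import Mathlib.LinearAlgebra.Projection
import Mathlib.LinearAlgebra.Matrix.Trace
import Mathlib.Data.Matrix.Basis
import Mathlib.Data.Matrix.Block
import HarnessLib

/-!
# K2_E3 road (h413), §L — kernel road «RICHARDSON» for (L-B_GL), brick (R3) GENERIC: THE FOURIER TRANSFORM OF A SUBSPACE IS ITS TRACE-ANNIHILATOR

Cell `pub/hodgecm-mathlib` (D-0151), Track B, seat K2E4-p09 (g3); deal (D57) of dealer K2E3-plan (g3) 2026-09-04T04:08Z, re-pointed 04:11Z to (a) «general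
subspace» + (b) «pattern ∕ parabolic letters» after K2E3-p11 (g4)'s ★ p857253 block form (`K2E3GLnNilBlockSubspaceFourier`: the maximal block parabolic
`[[0,X],[0,0]] ↦ [[A,C],[0,B]]` of `𝔤𝔩(m ⊕ n)`).  `--supports stmt-HodgeConjecture-24833 --as helper`; THEOREMS ONLY (no definition ∕ instance ∕ notation ∕ named fact ∕
`sorry`); never imports `Cruxes/…/Lines`.  COUNT-NEUTRAL: (L-B_GL) and its leaf (LBGL-ge3) (U12 ED. 11 :635) stay OPEN; this is the Fourier half of the Richardson
road for an ARBITRARY parabolic (K2E3-p11 (g4) MEMO «ROW 11 — SPLIT ROAD» v1 §4: `Λ_P(𝓕f) = c′ ∫_K ∫_𝔭 f(Ad(k) p) dp dk` from `∫_{𝔫_P} 𝓕 = c ∫_𝔭`).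

THE MATHEMATICS ([WeilBNT1967, Ch. II §5, Ch. VII §2]; [HarishChandra1999AdmissibleDistributions, §7, Thm. 4.4]; [Howe1974, Prop. 3]).  `F` a non-archimedean local
field, `ψ ≠ 1` a continuous additive character, `𝔤 = M_ι(F)` with the NON-DEGENERATE symmetric trace form `tr(XY)`, `𝓕f(Y) = ∫_𝔤 ψ(tr(Y Z)) f(Z) dμ𝔤(Z)` the §L
matrix Fourier transform ((LBGL-ge3) :635 tokens).  For an `F`-subspace `W ≤ 𝔤` with trace-annihilator `W' = {Y : tr(XY) = 0 ∀ X ∈ W}` and additive Haar measures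
`μW`, `μW'` on `W`, `W'`:  **`∫_W 𝓕f dμW = c · ∫_{W'} f dμW'` for every locally constant compactly supported `f : 𝔤 → ℂ`**, ONE `c > 0` (§4
`integral_matrixFourier_subspace_eq`).  PROOF.  §1 (any field): a complement `U` of `W'` is PERFECTLY paired with `W` by `tr` (left kernel `0` by non-degeneracy
and `W' ⊔ U = ⊤`, right kernel `W' ⊓ U = ⊥`), so `dim U = dim W = d` and `tr(w · u) = eW w ⬝ᵥ eU u` in a basis of `W` and its dual coordinates on `U`.  §2: linear
maps out of `M_ι(F)` ∕ `F^d` are continuous, so `Ψ : 𝔤 ≃ₜ+ W' × F^d` (`Z = y + eU⁻¹ v`) and `eW : W ≃ₜ+ F^d`; `W'` is closed, hence locally compact, σ-compact.  §4 =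
the transcript of ★ p857253 §f–§k on `Ψ`: Haar uniqueness `μ𝔤 = c₁ · Ψ⁻¹_*(μW' ⊗ μV)`, `μV := eW_* μW`; `tr(w · Ψ⁻¹(y, v)) = 0 + eW w ⬝ᵥ v`, so
`𝓕f(w) = c₁ ∫_{W'} Φ̂_y(eW w) dμW'`, `Φ_y(v) = f(y + eU⁻¹ v) ∈ 𝒮(F^d)` (uniform lattice of `f`, ★ `exists_forall_add_eq_of_entries_mem`, pulled back through the
continuity of `eU⁻¹` at `0`); Fubini for the continuous compactly supported kernel `(v, y) ↦ Φ̂_y(v)`; Fourier inversion at `0` on `F^d` (★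
`integral_piFourierSB_eq_const_mul_apply_zero`): `∫ Φ̂_y dμV = c_ψ Φ_y(0) = c_ψ f(y)`.  §5 (deal (b)): a coordinate PATTERN `W = {X : X i j = 0 off P}` has annihilator
`{Y : Y j i = 0 on P}`; for a block label `c : ι → α` the nilradical `𝔫_c = {X : c j ≤ c i → X i j = 0}` has annihilator the parabolic `𝔭_c = {Y : Y.BlockTriangular c}`
(Mathlib's `BlockTriangular` = the carrier of ★ `standardParabolicGL`), so **`∫_{𝔫_c} 𝓕f = c₀ · ∫_{𝔭_c} f` for EVERY standard parabolic of `GL_ι`, Borel included, no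
reindexing** (`integral_matrixFourier_nilradical_eq_parabolic`).  NOT here: the `K`-average of the Richardson measure and its `Ad(G)`-invariance ((R2), K2E3-p11 (g4)).

References: [WeilBNT1967] A. Weil, *Basic Number Theory* (1967), Ch. II §5 Thm. 3 (self-duality), Ch. VII §2 Prop. 2, Cor. 1 (Fourier transform on `𝒮`, inversion) ·
[HarishChandra1999AdmissibleDistributions] Harish-Chandra (DeBacker–Sally), *Admissible invariant distributions on reductive p-adic groups*, ULECT 16 (1999), §7,
Thm. 4.4 · [Howe1974] R. Howe, *The Fourier transform and germs of characters*, Math. Ann. 208 (1974), Prop. 3.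
HONEST LABEL: HC_CM is proved only modulo the 7 printed citations (2 remaining named inputs: hLiu418 = stmt-HodgeConjecture-24832, h413 = stmt-HodgeConjecture-24833)
until rung 0 closes; count-neutral helper.
-/

set_option autoImplicit false
set_option linter.dupNamespace false   -- `Summit.HodgeConjecture.HodgeConjecture.…` (D-0017 nested layout; lakefile exemption for Summits)

noncomputable section

open MeasureTheory MeasureTheory.Measure Matrix Module
open scoped ENNReal NNReal
open Literature.NumberTheory.Automorphic
open Literature.NumberTheory.GaloisRepresentations Literature.NumberTheory.GaloisRepresentations.IsNonarchimedeanLocalField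
open Summit.HodgeConjecture.HodgeConjecture.Cruxes.H413.K2E3GLnMaximalParabolicDescent
open Summit.HodgeConjecture.HodgeConjecture.Cruxes.H413.K2E3GLnNilBlockSubspaceFourier

namespace Summit.HodgeConjecture.HodgeConjecture.Cruxes.H413.K2E3LieSubspaceFourier

/-! ## §1  Linear algebra: a complement `U` of the annihilator `W'` is perfectly paired with `W` by the trace form, in dot-product coordinates -/

section Algebra

variable {F : Type*} [Field F] {ι : Type*} [Fintype ι] [DecidableEq ι]

/-- The trace form `tr(XY)` on `M_ι(F)` is non-degenerate: `tr(X Z) = 0` for all `Z` forces `X = 0`. [folklore] -/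
theorem eq_zero_of_forall_trace_mul_eq_zero {X : Matrix ι ι F} (h : ∀ Z : Matrix ι ι F, Matrix.trace (X * Z) = 0) : X = 0 :=
  Matrix.ext_iff_trace_mul_right.2 fun Z => by rw [h Z, zero_mul, Matrix.trace_zero]

/-- **Perfect pairing in coordinates.**  For a subspace `W ≤ M_ι(F)` with trace-annihilator `W'` (`Y ∈ W' ↔ tr(XY) = 0 ∀ X ∈ W`) there are a complement
`U` of `W'`, a dimension `d` and linear coordinates `eW : W ≃ F^d`, `eU : U ≃ F^d` with `tr(w · u) = eW w ⬝ᵥ eU u`: the trace pairing `W × U → F` is perfect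
(left kernel `0` by non-degeneracy and `W' ⊔ U = ⊤`, right kernel `W' ⊓ U = ⊥`), and `eU` is the dual of a basis of `W`.
[cite: WeilBNT1967, Ch. II §5 Thm. 3] -/
theorem exists_isCompl_dotProduct_coords (W W' : Submodule F (Matrix ι ι F)) (hW' : ∀ Y, Y ∈ W' ↔ ∀ X ∈ W, Matrix.trace (X * Y) = 0) :
    ∃ (U : Submodule F (Matrix ι ι F)) (_ : IsCompl W' U) (d : ℕ) (eW : ↥W ≃ₗ[F] (Fin d → F)) (eU : ↥U ≃ₗ[F] (Fin d → F)),
      ∀ (w : ↥W) (u : ↥U), Matrix.trace ((w : Matrix ι ι F) * (u : Matrix ι ι F)) = eW w ⬝ᵥ eU u := by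
  obtain ⟨U, hU⟩ := W'.exists_isCompl
  set d : ℕ := finrank F ↥W with hd
  let b : Basis (Fin d) F ↥W := Module.finBasis F ↥W
  -- the trace form as a bilinear map, the dual coordinates `φ u = (tr(b_i · u))_i` on `U`, and `θ : W → Dual U`
  let B : Matrix ι ι F →ₗ[F] Matrix ι ι F →ₗ[F] F := (LinearMap.mul F (Matrix ι ι F)).compr₂ (Matrix.traceLinearMap ι F F)
  let φ : ↥U →ₗ[F] (Fin d → F) := LinearMap.pi fun i => (B ((b i : ↥W) : Matrix ι ι F)) ∘ₗ U.subtype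
  have hφ : ∀ (u : ↥U) (i : Fin d), φ u i = Matrix.trace (((b i : ↥W) : Matrix ι ι F) * (u : Matrix ι ι F)) := fun u i => rfl
  let θ : ↥W →ₗ[F] Module.Dual F ↥U := (B ∘ₗ W.subtype).compl₂ U.subtype
  have hθ : ∀ (w : ↥W) (u : ↥U), θ w u = Matrix.trace ((w : Matrix ι ι F) * (u : Matrix ι ι F)) := fun w u => rfl
  -- the trace identity in the basis `b`
  have htr : ∀ (w : ↥W) (u : ↥U), Matrix.trace ((w : Matrix ι ι F) * (u : Matrix ι ι F)) = b.equivFun w ⬝ᵥ φ u := by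
    intro w u
    have hw : (w : Matrix ι ι F) = ∑ i, b.equivFun w i • ((b i : ↥W) : Matrix ι ι F) := by
      conv_lhs => rw [← b.sum_equivFun w]
      simp only [Submodule.coe_sum, Submodule.coe_smul]
    rw [hw, Finset.sum_mul, Matrix.trace_sum]
    simp only [dotProduct, hφ, Matrix.smul_mul, Matrix.trace_smul, smul_eq_mul]
  -- `φ` is injective (its kernel lies in `W' ⊓ U = ⊥`); `θ` is injective (a `w` killing `U` kills `W' ⊔ U = ⊤`, and `tr` is non-degenerate)
  have hφinj : Function.Injective φ := by
    rw [← LinearMap.ker_eq_bot, LinearMap.ker_eq_bot']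
    intro u hu
    have huW' : (u : Matrix ι ι F) ∈ W' :=
      (hW' _).2 fun X hX => by have h := htr ⟨X, hX⟩ u; rwa [hu, dotProduct_zero] at h
    have h0 : (u : Matrix ι ι F) ∈ W' ⊓ U := ⟨huW', u.2⟩
    rw [hU.inf_eq_bot, Submodule.mem_bot] at h0
    exact Subtype.ext h0
  have hθinj : Function.Injective θ := by
    rw [← LinearMap.ker_eq_bot, LinearMap.ker_eq_bot']
    intro w hw
    refine Subtype.ext (eq_zero_of_forall_trace_mul_eq_zero fun Z => ?_)
    have hZ : Z ∈ W' ⊔ U := by rw [hU.sup_eq_top]; exact Submodule.mem_top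
    obtain ⟨y, hy, u, hu, rfl⟩ := Submodule.mem_sup.1 hZ
    rw [mul_add, Matrix.trace_add, ((hW' y).1 hy) _ w.2, zero_add, ← hθ w ⟨u, hu⟩, hw, LinearMap.zero_apply]
  -- dimension count `dim U ≤ d ≤ dim Dual U = dim U`, so `φ` is bijective
  have h1 := LinearMap.finrank_le_finrank_of_injective hφinj
  have h2 := LinearMap.finrank_le_finrank_of_injective hθinj
  rw [Module.finrank_fintype_fun_eq_card, Fintype.card_fin] at h1
  rw [Subspace.dual_finrank_eq] at h2
  have hdim : finrank F ↥U = finrank F (Fin d → F) := by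
    rw [Module.finrank_fintype_fun_eq_card, Fintype.card_fin]; omega
  have hφbij : Function.Bijective φ := ⟨hφinj, (LinearMap.injective_iff_surjective_of_finrank_eq_finrank hdim).1 hφinj⟩
  exact ⟨U, hU, d, b.equivFun, LinearEquiv.ofBijective φ hφbij, fun w u => by rw [htr, LinearEquiv.ofBijective_apply]⟩

/-- **Trace-annihilator of a coordinate pattern** (deal (b)): if `W = {X : X i j = 0 whenever ¬ P i j}` then `Y ∈ {Y : Y j i = 0 whenever P i j}` iff
`tr(X Y) = 0` for all `X ∈ W` (test against the elementary matrices `single i j 1 ∈ W`). [folklore] -/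
theorem forall_trace_mul_eq_zero_iff_of_pattern (P : ι → ι → Prop) (W W' : Submodule F (Matrix ι ι F))
    (hW : ∀ X, X ∈ W ↔ ∀ i j, ¬ P i j → X i j = 0) (hW' : ∀ Y, Y ∈ W' ↔ ∀ i j, P i j → Y j i = 0) :
    ∀ Y, Y ∈ W' ↔ ∀ X ∈ W, Matrix.trace (X * Y) = 0 := by
  classical
  intro Y
  rw [hW']
  constructor
  · intro hY X hX
    rw [hW] at hX
    simp only [Matrix.trace, Matrix.diag, Matrix.mul_apply]
    refine Finset.sum_eq_zero fun i _ => Finset.sum_eq_zero fun j _ => ?_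
    by_cases hP : P i j
    · rw [hY i j hP, mul_zero]
    · rw [hX i j hP, zero_mul]
  · intro h i j hP
    have hmem : Matrix.single i j (1 : F) ∈ W := by
      rw [hW]
      intro i' j' hP'
      rw [Matrix.single_apply, if_neg]
      rintro ⟨rfl, rfl⟩
      exact hP' hP
    have h1 := h _ hmem
    rwa [Matrix.trace_single_mul, smul_eq_mul, one_mul] at h1

/-- **The nilradical and the parabolic of a block label are trace-annihilators** (deal (b)): for `c : ι → α`, `𝔫_c = {X : c j ≤ c i → X i j = 0}` (strictly
block-upper) and `𝔭_c = {Y : Y.BlockTriangular c}` (block-upper, the carrier of ★ `standardParabolicGL`), `Y ∈ 𝔭_c ↔ ∀ X ∈ 𝔫_c, tr(X Y) = 0`.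
[cite: HarishChandra1999AdmissibleDistributions, §7] -/
theorem forall_trace_mul_eq_zero_iff_of_blockLabel {α : Type*} [LinearOrder α] (c : ι → α) (𝔫 𝔭 : Submodule F (Matrix ι ι F))
    (h𝔫 : ∀ X, X ∈ 𝔫 ↔ ∀ i j, c j ≤ c i → X i j = 0) (h𝔭 : ∀ Y, Y ∈ 𝔭 ↔ Y.BlockTriangular c) :
    ∀ Y, Y ∈ 𝔭 ↔ ∀ X ∈ 𝔫, Matrix.trace (X * Y) = 0 := by
  refine forall_trace_mul_eq_zero_iff_of_pattern (fun i j => c i < c j) 𝔫 𝔭 (fun X => ?_) (fun Y => ?_)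
  · rw [h𝔫]
    simp only [not_lt]
  · rw [h𝔭, Matrix.BlockTriangular]
    exact ⟨fun h i j hij => h hij, fun h i j hij => h j i hij⟩

end Algebra

/-! ## §2  Topology: linear maps out of `M_ι(F)` and `F^d` are continuous; a subspace is homeomorphic to `F^{dim}`; the annihilator is closed -/

section Topology

variable {F : Type*} [Field F] [TopologicalSpace F] {ι : Type*} [Fintype ι]

/-- Every `F`-linear map out of `M_{ι×κ}(F)` into a topological `F`-module is continuous (the matrix topology is the finite product topology).
[cite: WeilBNT1967, Ch. I §2 Cor. 1 of Thm. 3] -/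
theorem continuous_linearMap_of_matrix {κ : Type*} [Fintype κ] {M : Type*} [AddCommGroup M] [Module F M] [TopologicalSpace M]
    [ContinuousAdd M] [ContinuousSMul F M] (f : Matrix ι κ F →ₗ[F] M) : Continuous f := by
  obtain ⟨e, -⟩ := exists_continuousLinearEquiv_entries (F := F) (m := ι) (n := κ)
  have h : Continuous (f ∘ₗ (e.symm : (ι × κ → F) ≃L[F] Matrix ι κ F).toLinearEquiv.toLinearMap) := LinearMap.continuous_on_pi _
  refine (h.comp e.continuous).congr fun X => ?_
  simp

/-- Linear coordinates `e : S ≃ F^d` on a subspace `S ≤ M_ι(F)` are a homeomorphism (`e` factors through a projection `M_ι(F) → S`, `e⁻¹` is a linear map out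
of `F^d`). [cite: WeilBNT1967, Ch. I §2 Cor. 1 of Thm. 3] -/
theorem continuous_coords_submodule [IsTopologicalRing F] (S : Submodule F (Matrix ι ι F)) {d : ℕ} (e : ↥S ≃ₗ[F] (Fin d → F)) :
    Continuous e ∧ Continuous e.symm := by
  obtain ⟨S₂, hS₂⟩ := S.exists_isCompl
  refine ⟨?_, LinearMap.continuous_on_pi e.symm.toLinearMap⟩
  have h : Continuous (e.toLinearMap ∘ₗ Submodule.projectionOnto S S₂ hS₂) := continuous_linearMap_of_matrix _
  refine (h.comp continuous_subtype_val).congr fun s => ?_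
  simp [Submodule.projectionOnto_apply_left]

/-- The trace-annihilator `W' = ⋂_{X ∈ W} ker (Y ↦ tr(XY))` is closed. [folklore] -/
theorem isClosed_annihilator [IsTopologicalRing F] [T2Space F] (W W' : Submodule F (Matrix ι ι F)) (hW' : ∀ Y, Y ∈ W' ↔ ∀ X ∈ W, Matrix.trace (X * Y) = 0) :
    IsClosed (W' : Set (Matrix ι ι F)) := by
  have h : (W' : Set (Matrix ι ι F)) = ⋂ X ∈ (W : Set (Matrix ι ι F)), {Y | Matrix.trace (X * Y) = 0} := by
    ext Y
    simp only [SetLike.mem_coe, Set.mem_iInter, Set.mem_setOf_eq]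
    exact hW' Y
  rw [h]
  exact isClosed_biInter fun X _ => isClosed_eq ((continuous_const.matrix_mul continuous_id).matrix_trace) continuous_const

end Topology

/-! ## §3–§4  The theorem: `∫_W 𝓕f dμW = c · ∫_{W'} f dμW'` -/

section Main

variable {F : Type*} [Field F] [ValuativeRel F] [TopologicalSpace F] [IsNonarchimedeanLocalField F]
  {ι : Type*} [Fintype ι] [DecidableEq ι]
  [MeasurableSpace (Matrix ι ι F)] [BorelSpace (Matrix ι ι F)]

/-- **THE FOURIER TRANSFORM OF A SUBSPACE IS ITS TRACE-ANNIHILATOR (brick (R3), generic form; deal (D57)(a)).**  `F` a non-archimedean local field, `ψ` a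
continuous non-trivial additive character, `μ𝔤` an additive Haar measure on `𝔤 = M_ι(F)`, `W ≤ 𝔤` any `F`-subspace, `W'` its trace-annihilator (given by
the letter `hW'`), `μW`, `μW'` additive Haar measures on `W`, `W'`.  There is ONE `c > 0` such that for every locally constant compactly supported `f : 𝔤 → ℂ`,
`∫_W (∫_𝔤 ψ(tr(w Z)) f(Z) dμ𝔤(Z)) dμW(w) = c · ∫_{W'} f(y) dμW'(y)`.  For `W = 𝔫_P` the nilradical of a parabolic, `W' = 𝔭` (§5): the Richardson road's
`Λ_P(𝓕f) = c ∫_K ∫_𝔭 f(Ad(k)p)`.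
[cite: WeilBNT1967, Ch. VII §2 Cor. 1; Ch. II §5 Thm. 3] [cite: HarishChandra1999AdmissibleDistributions, §7, Thm. 4.4] [cite: Howe1974, Prop. 3] -/
theorem integral_matrixFourier_subspace_eq (ψ : AddChar F Circle) (hψ : ψ.IsContinuousNontrivial)
    (μ𝔤 : Measure (Matrix ι ι F)) [μ𝔤.IsAddHaarMeasure]
    (W W' : Submodule F (Matrix ι ι F)) (hW' : ∀ Y, Y ∈ W' ↔ ∀ X ∈ W, Matrix.trace (X * Y) = 0)
    [MeasurableSpace ↥W] [BorelSpace ↥W] (μW : Measure ↥W) [μW.IsAddHaarMeasure]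
    [MeasurableSpace ↥W'] [BorelSpace ↥W'] (μW' : Measure ↥W') [μW'.IsAddHaarMeasure] :
    ∃ c : ℝ, 0 < c ∧ ∀ f : Matrix ι ι F → ℂ, IsLocallyConstant f → HasCompactSupport f →
      ∫ w, (∫ Z, ((ψ (Matrix.trace ((w : Matrix ι ι F) * Z)) : Circle) : ℂ) * f Z ∂μ𝔤) ∂μW = (c : ℂ) * ∫ y, f (y : Matrix ι ι F) ∂μW' := by
  -- §a instances on `F`, `𝔤`, `V = F^d`, `W'`
  haveI : T2Space F := (isLocalField F).toT2Space
  haveI : SecondCountableTopology F := secondCountableTopology_localField F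
  haveI : LocallyCompactSpace (Matrix ι ι F) := locallyCompactSpace_matrix
  haveI : SecondCountableTopology (Matrix ι ι F) := secondCountableTopology_matrix
  haveI : LocallyCompactSpace ↥W' := (isClosed_annihilator W W' hW').isClosedEmbedding_subtypeVal.locallyCompactSpace
  obtain ⟨mψ, hm⟩ := hψ.exists_hasConductorExp
  -- §b the perfect pairing in coordinates and the homeomorphisms `eW : W ≃ₜ+ V`, `Ψ : 𝔤 ≃ₜ+ W' × V`
  obtain ⟨U, hU, d, eW, eU, htr⟩ := exists_isCompl_dotProduct_coords W W' hW'
  letI : MeasurableSpace (Fin d → F) := borel _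
  haveI : BorelSpace (Fin d → F) := ⟨rfl⟩
  obtain ⟨heW, heWs⟩ := continuous_coords_submodule W eW
  have heUs : Continuous fun v : Fin d → F => ((eU.symm v : ↥U) : Matrix ι ι F) :=
    continuous_subtype_val.comp (continuous_coords_submodule U eU).2
  obtain ⟨eWc, heWc⟩ : ∃ eWc : ↥W ≃ₜ+ (Fin d → F), ∀ w, eWc w = eW w :=
    ⟨{ eW.toAddEquiv with continuous_toFun := heW, continuous_invFun := heWs }, fun w => rfl⟩
  obtain ⟨Ψ, hΨs⟩ : ∃ Ψ : Matrix ι ι F ≃ₜ+ (↥W' × (Fin d → F)),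
      ∀ (y : ↥W') (v : Fin d → F), Ψ.symm (y, v) = (y : Matrix ι ι F) + ((eU.symm v : ↥U) : Matrix ι ι F) := by
    let L : Matrix ι ι F ≃ₗ[F] (↥W' × (Fin d → F)) := (Submodule.prodEquivOfIsCompl W' U hU).symm.trans ((LinearEquiv.refl F ↥W').prodCongr eU)
    have hLs : ∀ (y : ↥W') (v : Fin d → F), L.symm (y, v) = (y : Matrix ι ι F) + ((eU.symm v : ↥U) : Matrix ι ι F) := by
      intro y v
      simp [L, Submodule.coe_prodEquivOfIsCompl']
    refine ⟨{ L.toAddEquiv with continuous_toFun := continuous_linearMap_of_matrix L.toLinearMap, continuous_invFun := ?_ }, hLs⟩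
    change Continuous fun q : ↥W' × (Fin d → F) => L.symm q
    have h : (fun q : ↥W' × (Fin d → F) => L.symm q) = fun q => (q.1 : Matrix ι ι F) + ((eU.symm q.2 : ↥U) : Matrix ι ι F) :=
      funext fun q => hLs q.1 q.2
    rw [h]
    exact (continuous_subtype_val.comp continuous_fst).add (heUs.comp continuous_snd)
  -- §c the transported measure `μV = (eW)_* μW` on `V`, the product measure on `W' × V`, Haar uniqueness for `μ𝔤`
  obtain ⟨μV, hμV⟩ : ∃ μV : Measure (Fin d → F), μV = μW.map eWc := ⟨_, rfl⟩
  haveI : μV.IsAddHaarMeasure := by rw [hμV]; exact eWc.isAddHaarMeasure_map μW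
  haveI : SecondCountableTopology ↥W' := TopologicalSpace.Subtype.secondCountableTopology (W' : Set (Matrix ι ι F))
  haveI : SFinite μW' := inferInstance
  haveI : (μW'.prod μV).IsAddHaarMeasure := inferInstance
  obtain ⟨ν, hν⟩ : ∃ ν : Measure (Matrix ι ι F), ν = (μW'.prod μV).map Ψ.symm := ⟨_, rfl⟩
  haveI : ν.IsAddHaarMeasure := by rw [hν]; exact Ψ.symm.isAddHaarMeasure_map (μW'.prod μV)
  have hμ𝔤 : μ𝔤 = μ𝔤.addHaarScalarFactor ν • ν := isAddLeftInvariant_eq_smul μ𝔤 ν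
  obtain ⟨c₁, hc₁⟩ : ∃ c₁ : ℝ≥0, c₁ = μ𝔤.addHaarScalarFactor ν := ⟨_, rfl⟩
  have hc₁pos : 0 < c₁ := by rw [hc₁]; exact addHaarScalarFactor_pos_of_isAddHaarMeasure μ𝔤 ν
  rw [← hc₁] at hμ𝔤
  have hΨm : MeasurableEmbedding (Ψ.symm : ↥W' × (Fin d → F) → Matrix ι ι F) := Ψ.symm.toHomeomorph.measurableEmbedding
  have heWm : MeasurableEmbedding (eWc : ↥W → (Fin d → F)) := eWc.toHomeomorph.measurableEmbedding
  -- §d the constant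
  refine ⟨(c₁ : ℝ) * piSelfDualConst F (Fin d) μV mψ, mul_pos (NNReal.coe_pos.2 hc₁pos) (piSelfDualConst_pos μV), fun f hf hfc => ?_⟩
  -- §e the uniform lattice of `f`, pulled back to `V` through the continuity of `eU⁻¹` at `0`
  obtain ⟨N, hN⟩ := exists_forall_add_eq_of_entries_mem (F := F) hf hfc
  obtain ⟨N', hN'⟩ : ∃ N' : ℕ, ∀ t ∈ piPrimePowBall F (Fin d) (N' : ℤ), ∀ i j, ((eU.symm t : ↥U) : Matrix ι ι F) i j ∈ primePowBall F N := by
    obtain ⟨eg, heg⟩ := exists_continuousLinearEquiv_entries (F := F) (m := ι) (n := ι)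
    have hB : (fun v : Fin d → F => ((eU.symm v : ↥U) : Matrix ι ι F)) ⁻¹' (eg ⁻¹' piPrimePowBall F (ι × ι) N) ∈ nhds (0 : Fin d → F) := by
      refine ((isOpen_piPrimePowBall N).preimage (eg.continuous.comp heUs)).mem_nhds ?_
      show eg ((eU.symm 0 : ↥U) : Matrix ι ι F) ∈ piPrimePowBall F (ι × ι) N
      rw [map_zero, Submodule.coe_zero, map_zero]
      exact zero_mem_piPrimePowBall N
    obtain ⟨N', hN'⟩ := exists_piPrimePowBall_subset_of_mem_nhds_zero hB
    refine ⟨N', fun t ht i j => ?_⟩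
    have h := mem_piPrimePowBall_iff.1 (hN' ht) (i, j)
    rwa [heg] at h
  set Φ : ↥W' → (Fin d → F) → ℂ := fun y v => f (Ψ.symm (y, v)) with hΦ
  have hΦN : ∀ y, ∀ v, ∀ t ∈ piPrimePowBall F (Fin d) (N' : ℤ), Φ y (v + t) = Φ y v := by
    intro y v t ht
    have h1 : Ψ.symm (y, v + t) = Ψ.symm (y, v) + Ψ.symm (0, t) := by
      rw [← map_add, Prod.mk_add_mk, add_zero]
    have h2 : Ψ.symm ((0 : ↥W'), t) = ((eU.symm t : ↥U) : Matrix ι ι F) := by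
      rw [hΨs, Submodule.coe_zero, zero_add]
    simp only [hΦ, h1, h2]
    exact hN _ _ (hN' t ht)
  -- §f the compact `V`- and `W'`-shadows of the support of `f`
  set SV : Set (Fin d → F) := Prod.snd '' (Ψ '' tsupport f) with hSV
  have hSVc : IsCompact SV := (hfc.image Ψ.continuous).image continuous_snd
  set SW : Set ↥W' := Prod.fst '' (Ψ '' tsupport f) with hSW
  have hSWc : IsCompact SW := (hfc.image Ψ.continuous).image continuous_fst
  have hΦzero : ∀ y v, (y, v) ∉ Ψ '' tsupport f → Φ y v = 0 := by
    intro y v hyv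
    simp only [hΦ]
    refine image_eq_zero_of_notMem_tsupport fun h => hyv ?_
    exact ⟨Ψ.symm (y, v), h, by simp⟩
  have hΦV : ∀ y, ∀ v ∉ SV, Φ y v = 0 := fun y v hv =>
    hΦzero y v fun h => hv ⟨(y, v), h, rfl⟩
  have hΦW : ∀ y ∉ SW, ∀ v, Φ y v = 0 := fun y hy v =>
    hΦzero y v fun h => hy ⟨(y, v), h, rfl⟩
  have hΦsb : ∀ y, Φ y ∈ SchwartzBruhat (Fin d → F) := by
    intro y
    rw [mem_schwartzBruhat_iff]
    refine ⟨?_, HasCompactSupport.intro hSVc (hΦV y)⟩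
    exact hf.comp_continuous (Ψ.symm.continuous.comp (Continuous.prodMk_right y))
  -- §g the integrand after the decomposition: `ψ(tr(w · Ψ⁻¹(y, v))) f(Ψ⁻¹(y, v)) = ψ(v ⬝ᵥ eW w) Φ y v`
  have hker : ∀ (w : ↥W) (y : ↥W') (v : Fin d → F),
      ((ψ (Matrix.trace ((w : Matrix ι ι F) * Ψ.symm (y, v))) : Circle) : ℂ) * f (Ψ.symm (y, v)) = ((ψ (v ⬝ᵥ eWc w) : Circle) : ℂ) * Φ y v := by
    intro w y v
    simp only [hΦ]
    rw [hΨs, mul_add, Matrix.trace_add, ((hW' _).1 y.2) _ w.2, zero_add, htr, LinearEquiv.apply_symm_apply, heWc, dotProduct_comm]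
  -- §h STEP 1: the inner integral through `ν` and Fubini on `W' × V`
  have hstep1 : ∀ w : ↥W,
      ∫ Z, ((ψ (Matrix.trace ((w : Matrix ι ι F) * Z)) : Circle) : ℂ) * f Z ∂μ𝔤 = ((c₁ : ℝ) : ℂ) * ∫ y, piFourierSB ψ μV (Φ y) (eWc w) ∂μW' := by
    intro w
    have hcont : Continuous fun Z : Matrix ι ι F => ((ψ (Matrix.trace ((w : Matrix ι ι F) * Z)) : Circle) : ℂ) * f Z := by
      refine Continuous.mul ?_ hf.continuous
      exact continuous_subtype_val.comp (hψ.1.comp ((continuous_const.matrix_mul continuous_id).matrix_trace))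
    have hint : Integrable (fun q : ↥W' × (Fin d → F) =>
        ((ψ (Matrix.trace ((w : Matrix ι ι F) * Ψ.symm q)) : Circle) : ℂ) * f (Ψ.symm q)) (μW'.prod μV) := by
      refine Continuous.integrable_of_hasCompactSupport (hcont.comp Ψ.symm.continuous) ?_
      exact (hfc.comp_homeomorph Ψ.symm.toHomeomorph).mul_left
    calc ∫ Z, ((ψ (Matrix.trace ((w : Matrix ι ι F) * Z)) : Circle) : ℂ) * f Z ∂μ𝔤
        = ∫ Z, ((ψ (Matrix.trace ((w : Matrix ι ι F) * Z)) : Circle) : ℂ) * f Z ∂(c₁ • ν) := by rw [← hμ𝔤]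
      _ = c₁ • ∫ Z, ((ψ (Matrix.trace ((w : Matrix ι ι F) * Z)) : Circle) : ℂ) * f Z ∂ν := integral_smul_nnreal_measure _ c₁
      _ = ((c₁ : ℝ) : ℂ) * ∫ Z, ((ψ (Matrix.trace ((w : Matrix ι ι F) * Z)) : Circle) : ℂ) * f Z ∂ν := by
          rw [NNReal.smul_def, Complex.real_smul]
      _ = ((c₁ : ℝ) : ℂ) * ∫ q, ((ψ (Matrix.trace ((w : Matrix ι ι F) * Ψ.symm q)) : Circle) : ℂ) * f (Ψ.symm q) ∂(μW'.prod μV) := by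
          rw [hν, hΨm.integral_map]
      _ = ((c₁ : ℝ) : ℂ) * ∫ y, ∫ v, ((ψ (Matrix.trace ((w : Matrix ι ι F) * Ψ.symm (y, v))) : Circle) : ℂ) * f (Ψ.symm (y, v)) ∂μV ∂μW' := by
          rw [integral_prod _ hint]
      _ = ((c₁ : ℝ) : ℂ) * ∫ y, piFourierSB ψ μV (Φ y) (eWc w) ∂μW' := by
          congr 1
          refine integral_congr_ae (Filter.Eventually.of_forall fun y => ?_)
          simp only [hker, piFourierSB_apply]
  -- §i STEP 2: the kernel `G(x, y) = Φ̂_y(x)` is continuous with compact support on `V × W'`, hence Fubini in `(x, y)`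
  have hGcont : Continuous (Function.uncurry fun (x : Fin d → F) (y : ↥W') => piFourierSB ψ μV (Φ y) x) := by
    have hK : Continuous (Function.uncurry fun (xy : (Fin d → F) × ↥W') (v : Fin d → F) =>
        ((ψ (v ⬝ᵥ xy.1) : Circle) : ℂ) * Φ xy.2 v) := by
      simp only [hΦ, Function.uncurry_def]
      refine Continuous.mul ?_ ?_
      · refine continuous_subtype_val.comp (hψ.1.comp ?_)
        exact Continuous.dotProduct continuous_snd (continuous_fst.comp continuous_fst)
      · exact hf.continuous.comp (Ψ.symm.continuous.comp ((continuous_snd.comp continuous_fst).prodMk continuous_snd))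
    have h := continuous_parametric_integral_of_continuous (μ := μV) hK hSVc
    refine h.congr fun xy => ?_
    simp only [piFourierSB_apply]
    change ∫ v in SV, ((ψ (v ⬝ᵥ xy.1) : Circle) : ℂ) * Φ xy.2 v ∂μV = ∫ v, ((ψ (v ⬝ᵥ xy.1) : Circle) : ℂ) * Φ xy.2 v ∂μV
    exact setIntegral_eq_integral_of_forall_compl_eq_zero fun v hv => by rw [hΦV xy.2 v hv, mul_zero]
  have hGsupp : HasCompactSupport (Function.uncurry fun (x : Fin d → F) (y : ↥W') => piFourierSB ψ μV (Φ y) x) := by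
    refine HasCompactSupport.intro ((isCompact_piPrimePowBall (mψ - N')).prod hSWc) ?_
    rintro ⟨x, y⟩ hxy
    simp only [Set.mem_prod, not_and_or] at hxy
    simp only [Function.uncurry_apply_pair]
    rcases hxy with hx | hy
    · exact piFourierSB_eq_zero_of_notMem ψ μV hm (hΦN y) hx
    · rw [piFourierSB_apply]
      simp [hΦW y hy]
  have hGint : Integrable (Function.uncurry fun (x : Fin d → F) (y : ↥W') => piFourierSB ψ μV (Φ y) x) (μV.prod μW') :=
    hGcont.integrable_of_hasCompactSupport hGsupp
  -- §j STEP 3: for each `y`, Fourier inversion at `0` on `V`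
  have hstep3 : ∀ y : ↥W', ∫ x, piFourierSB ψ μV (Φ y) x ∂μV = (piSelfDualConst F (Fin d) μV mψ : ℂ) * f (y : Matrix ι ι F) := by
    intro y
    rw [integral_piFourierSB_eq_const_mul_apply_zero μV hψ hm (hΦsb y)]
    simp only [hΦ, hΨs, map_zero, Submodule.coe_zero, add_zero]
  -- §k assembly: transport `∫ dμW` to `∫ dμV`, swap, invert
  have hstep0 : ∫ w, ((c₁ : ℝ) : ℂ) * ∫ y, piFourierSB ψ μV (Φ y) (eWc w) ∂μW' ∂μW = ∫ x, ((c₁ : ℝ) : ℂ) * ∫ y, piFourierSB ψ μV (Φ y) x ∂μW' ∂μV := by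
    rw [hμV, heWm.integral_map]
  calc ∫ w, (∫ Z, ((ψ (Matrix.trace ((w : Matrix ι ι F) * Z)) : Circle) : ℂ) * f Z ∂μ𝔤) ∂μW
      = ∫ w, ((c₁ : ℝ) : ℂ) * ∫ y, piFourierSB ψ μV (Φ y) (eWc w) ∂μW' ∂μW := by
        refine integral_congr_ae (Filter.Eventually.of_forall fun w => ?_)
        exact hstep1 w
    _ = ∫ x, ((c₁ : ℝ) : ℂ) * ∫ y, piFourierSB ψ μV (Φ y) x ∂μW' ∂μV := hstep0
    _ = ((c₁ : ℝ) : ℂ) * ∫ x, ∫ y, piFourierSB ψ μV (Φ y) x ∂μW' ∂μV := integral_const_mul _ _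
    _ = ((c₁ : ℝ) : ℂ) * ∫ y, ∫ x, piFourierSB ψ μV (Φ y) x ∂μV ∂μW' := by rw [integral_integral_swap hGint]
    _ = ((c₁ : ℝ) : ℂ) * ∫ y, (piSelfDualConst F (Fin d) μV mψ : ℂ) * f (y : Matrix ι ι F) ∂μW' := by
        congr 1
        exact integral_congr_ae (Filter.Eventually.of_forall fun y => hstep3 y)
    _ = (((c₁ : ℝ) * piSelfDualConst F (Fin d) μV mψ : ℝ) : ℂ) * ∫ y, f (y : Matrix ι ι F) ∂μW' := by
        rw [integral_const_mul, Complex.ofReal_mul, mul_assoc]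

/-! ## §5  The parabolic letters (deal (D57)(b)): `∫_{𝔫_c} 𝓕f = c · ∫_{𝔭_c} f` for every standard parabolic of `GL_ι`, no reindexing -/

/-- **SUBSPACE FOURIER FOR THE NILRADICAL OF ANY STANDARD PARABOLIC** (deal (D57)(b)): for a block label `c : ι → α`, the nilradical
`𝔫_c = {X : c j ≤ c i → X i j = 0}` and the parabolic `𝔭_c = {Y : Y.BlockTriangular c}` (letters `h𝔫`, `h𝔭`), and additive Haar measures `μ𝔫`, `μ𝔭`:
`∃ c₀ > 0, ∀ f ∈ C_c^∞(𝔤), ∫_{𝔫_c} 𝓕f dμ𝔫 = c₀ · ∫_{𝔭_c} f dμ𝔭` — every standard parabolic of `GL_ι(F)` at once (Borel: `c = id` on `Fin N`; maximal: two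
values of `c`, cf. ★ p857253's `fromBlocks` form). [cite: HarishChandra1999AdmissibleDistributions, §7, Thm. 4.4] [cite: WeilBNT1967, Ch. VII §2 Cor. 1] -/
theorem integral_matrixFourier_nilradical_eq_parabolic (ψ : AddChar F Circle) (hψ : ψ.IsContinuousNontrivial)
    (μ𝔤 : Measure (Matrix ι ι F)) [μ𝔤.IsAddHaarMeasure] {α : Type*} [LinearOrder α] (c : ι → α)
    (𝔫 𝔭 : Submodule F (Matrix ι ι F)) (h𝔫 : ∀ X, X ∈ 𝔫 ↔ ∀ i j, c j ≤ c i → X i j = 0) (h𝔭 : ∀ Y, Y ∈ 𝔭 ↔ Y.BlockTriangular c)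
    [MeasurableSpace ↥𝔫] [BorelSpace ↥𝔫] (μ𝔫 : Measure ↥𝔫) [μ𝔫.IsAddHaarMeasure]
    [MeasurableSpace ↥𝔭] [BorelSpace ↥𝔭] (μ𝔭 : Measure ↥𝔭) [μ𝔭.IsAddHaarMeasure] :
    ∃ c₀ : ℝ, 0 < c₀ ∧ ∀ f : Matrix ι ι F → ℂ, IsLocallyConstant f → HasCompactSupport f →
      ∫ n, (∫ Z, ((ψ (Matrix.trace ((n : Matrix ι ι F) * Z)) : Circle) : ℂ) * f Z ∂μ𝔤) ∂μ𝔫 = (c₀ : ℂ) * ∫ p, f (p : Matrix ι ι F) ∂μ𝔭 :=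
  integral_matrixFourier_subspace_eq ψ hψ μ𝔤 𝔫 𝔭 (forall_trace_mul_eq_zero_iff_of_blockLabel c 𝔫 𝔭 h𝔫 h𝔭) μ𝔫 μ𝔭

end Main

end Summit.HodgeConjecture.HodgeConjecture.Cruxes.H413.K2E3LieSubspaceFourier

end
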